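import Literature.Analysis.FluidPDE.FiniteEnergyClassicalHeatLowPass
import Literature.Analysis.FluidPDE.TaoLocalisationHolds
import Literature.Analysis.FluidPDE.NSCriticalClosureTao
import Literature.Analysis.FluidPDE.NSVorticityBKMContinuation
import Literature.Analysis.FluidPDE.ClayClassLerayHopfUniqueness
import Literature.Analysis.FluidPDE.NSTaoClassOfSobolevDatum
import HarnessLib

/-!
# `L²` decay of finite-energy classical solutions of Navier–Stokes on `ℝ³`:
# `‖u(t)‖_{L²} → 0` as `t → ∞` (Masuda 1984; Kato 1984, §4; Leray 1934, §34)

Analysis/FluidPDE proof file (theorems only; no definitions, no named facts). Third of three files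
(tools: `OseenDuhamelHeatLowPassL2.lean`; slab lemmas: `FiniteEnergyClassicalHeatLowPass.lean`). For `ν > 0` and a
classical solution `(u, p)` of the unforced Navier–Stokes system on every slab `[0, T] × ℝ³` whose
datum `u(0)` has rapidly decaying derivatives (Fefferman (4)) and whose energy is uniformly bounded
(Fefferman (7)), the kinetic energy tends to zero:

* `EnergyDecay.tendsto_lintegral_enorm_sq_atTop_of_hasBoundedSobolevNormsOn` — `∫|u(t)|² → 0` under slab
  boundedness of the Sobolev norms (Tao's class); `…_of_finiteEnergy_classical` (rapidly decaying datum,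
  Tao 2013 Cor. 11.1) and `…_of_sobolevDatum` (`H^∞` datum) are its two instances;
* `IsNavierStokesSolution.tendsto_lintegral_enorm_sq_atTop` — the same in the Clay-class vocabulary
  (`IsNavierStokesSolution ν 0 u₀ u p`, `IsSmoothOnHalfSpace`, `HasBoundedEnergy`,
  `HasRapidSpatialDecay u₀`), which is token for token the body of the claim-skeleton Props
  `Literature.Claims.NS.ArandaIcardo2025.Step_7` and `Literature.Claims.NS.PaiLimsuwan2026.Step9_Decay`
  (cell `ns-claims`, D-0090: two TRUE-type consumed steps whose classical source is Masuda/Kato, not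
  the claims); `IsNavierStokesSolution.tendsto_integral_norm_sq_atTop` is the real-valued (Bochner) form.

No decay RATE is asserted: none holds uniformly on `L²` data (Schonbek; the tree's barrier
`Literature.Barriers.NavierStokesRegularity.FreeHeatDecaySharp`).

## The argument (Kato's `L²`-decay mechanism without Fourier splitting)

1. *Energy* (Tao 2013, Lemma 8.1 in the sharp form = Leray's energy equality; tree
   `IsClassicalNSSolutionOn.energyEq_of_finiteEnergy`): `t ↦ ‖u(t)‖₂` is non-increasing and
   `ν ∫₀^∞ ‖∇u‖₂² ≤ ½‖u(0)‖₂²`; hence every slab `[0, T]` with `ν δ T > ½‖u(0)‖₂²` contains a *good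
   time* `τ` with `‖∇u(τ)‖² ≤ δ` (`EnergyDecay.exists_good_time`).
2. *Low pass* (`EnergyDecay.exists_eLpNorm_two_heatExtension_slice_le`): by the Oseen representation
   `u(t) = e^{νtΔ}u(0) - B^ν_0(u,u)(t)` a.e. (Lemarié-Rieusset 2016, Thm. 6.1; tree
   `IsClassicalNSSolutionOn.ae_eq_forced_oseenMild` with zero force — the boundedness of `u` on slabs
   it needs is Tao 2013, Cor. 11.1, `tao2011_hasBoundedSobolevNormsOn_holds`, which is where the rapid
   decay of the datum enters), the semigroup laws `e^{νsΔ}e^{νtΔ} = e^{ν(s+t)Δ}`,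
   `e^{νsΔ}N_σ = N_{σ+νs}` (tree `heatExtension_oseenDuhamel_eq_setIntegral`), Minkowski in time and
   the `L¹ → L²` slice bound `‖N_σ[a, a]‖₂ ≤ C σ^{-5/4}‖a‖₂²` (Kato 1984, (2.3)–(2.4′) at the endpoint
   `p = 1`; `EnergyDecay.exists_eLpNorm_two_oseenSlice_le_eLpNorm_one`),
   `‖e^{νsΔ}u(t)‖₂ ≤ ‖e^{νsΔ}u(0)‖₂ + 4 C E ν^{-5/4} s^{-1/4}` **uniformly in `t`**, and
   `‖e^{νsΔ}u(0)‖₂ → 0` as `s → ∞` (`EnergyDecay.tendsto_eLpNorm_two_heatExtension_atTop`).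
3. *Defect* (Ledoux 2003; tree `integral_norm_sq_sub_heatExtension_le`): at a good time,
   `‖u(τ) - e^{νsΔ}u(τ)‖₂ ≤ √(3νs δ)` (`EnergyDecay.eLpNorm_sub_heatExtension_le_of_dissipation`).
4. Given `ε`: choose `s` (step 2), then `δ` (step 3), then `T` (step 1); monotonicity carries the
   bound `‖u(τ)‖₂ ≤ ε` from the good time to all later times.

## Mathlib / tree search

`lean search 'Masuda|Schonbek|Wiegner|tendsto_energy|EnergyDecay'`: no decay-to-zero theorem in the
tree (only `ClassicalPolynomialDecayPersistence` — persistence of pointwise decay — and the `L³`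
free-flow decay `GIP2003.tendsto_eLpNorm_heatExtension_three_atTop`, whose proof is copied here for
`L²`). The `L¹ → L²` slice endpoint is new (`exists_eLpNorm_oseenSlice_le` starts at `p > 1`).
Everything else is cited by name above.

## References

* K. Masuda, *Weak solutions of Navier–Stokes equations*, Tôhoku Math. J. 36 (1984) 623–646,
  Thm. 4 with Cor. 2 and the following remark, pp. 628–629 (decay `‖u(t)‖₂ → 0` for Leray's weak
  solutions; Thm. 2, p. 627, is the uniqueness theorem). [Masuda1984]
* T. Kato, *Strong `Lᵖ`-solutions of the Navier–Stokes equation in `ℝᵐ`, with applications to weak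
  solutions*, Math. Z. 187 (1984) 471–480, §2 (2.3)–(2.4′), §4. [Kato1984]
* J. Leray, *Sur le mouvement d'un liquide visqueux emplissant l'espace*, Acta Math. 63 (1934),
  §17 (3.4), §34. [Leray1934]
* P. G. Lemarié-Rieusset, *The Navier–Stokes Problem in the 21st Century*, CRC Press 2016,
  Thm. 6.1, Prop. 6.4 (6.10), Prop. 6.5. [LemarieRieusset2016]
* T. Tao, *Localisation and compactness properties of the Navier–Stokes global regularity problem*,
  Anal. PDE 6 (2013) = arXiv:1108.1165, Lemma 8.1, Cor. 11.1. [Tao2011]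
* M. Ledoux, *On improved Sobolev embedding theorems*, Math. Res. Lett. 10 (2003), §1. [Ledoux2003]
-/


noncomputable section

open MeasureTheory Set Function Filter Metric Real
open _root_.Topology
open scoped ENNReal NNReal

namespace Literature.Analysis.FluidPDE

open UnboundedOperators (heatKernel heatExtension)

namespace EnergyDecay

/-- `∫ |v|² = ‖v‖_{L²}²` in `ℝ≥0∞`. [folklore] -/
private theorem lintegral_enorm_sq_eq_eLpNorm_sq (v : EuclideanSpace ℝ (Fin 3) → EuclideanSpace ℝ (Fin 3)) :
    ∫⁻ x, ‖v x‖ₑ ^ 2 = eLpNorm v 2 volume ^ 2 := by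
  rw [eLpNorm_eq_lintegral_rpow_enorm_toReal two_ne_zero ENNReal.ofNat_ne_top, ENNReal.toReal_ofNat,
    ← ENNReal.rpow_natCast, ← ENNReal.rpow_mul]
  norm_num

/-- **`L²` decay of finite-energy classical solutions on `ℝ³` — general form (Masuda 1984, Thm. 4 / Cor. 2
for this class; Kato 1984, §4).** Let `ν > 0` and let `(u, p)` be a classical solution of the unforced
Navier–Stokes system on every closed slab `[0, T] × ℝ³` whose Sobolev norms are bounded on every such slab
(`HasBoundedSobolevNormsOn (Icc 0 T) u` — Tao's class: true for data of rapid decay by Tao 2013 Cor. 11.1,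
and for `H^∞` data by the tree's `hasBoundedSobolevNormsOn_of_sobolevDatum_unforced`) and whose energy is
uniformly bounded, `∫ |u(t)|² ≤ C < ∞` for `t ≥ 0`. Then `∫ |u(t, x)|² dx → 0` as `t → ∞`.

Proof (all inputs are tree theorems): energy equality (Tao 2013 Lemma 8.1) ⇒ `‖u(t)‖₂` non-increasing
and `ν∫₀^∞‖∇u‖₂² ≤ ½‖u₀‖₂²`, so long slabs contain times `τ` with `‖∇u(τ)‖₂² ≤ δ`; at such a time
`‖u(τ)‖₂ ≤ ‖e^{νsΔ}u(τ)‖₂ + √(3νsδ)` (Ledoux's defect bound) and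
`‖e^{νsΔ}u(τ)‖₂ ≤ ‖e^{νsΔ}u₀‖₂ + C E (νs)^{-1/4}·ν^{-1}` uniformly in `τ` (Oseen representation, heat
low-pass of the Duhamel term through the energy); `‖e^{νsΔ}u₀‖₂ → 0` (`s → ∞`). No rate is asserted
(none holds uniformly on `L²` data). The boundedness of `u` on slabs needed by the Oseen
representation is Tao 2013, Cor. 11.1 (`tao2011_hasBoundedSobolevNormsOn_holds`), which is where the
slab boundedness is the only place Tao's class enters. [cite: Masuda1984, Thm. 4 and Cor. 2 (pp. 628–629)] [cite: Kato1984, §4] -/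
theorem tendsto_lintegral_enorm_sq_atTop_of_hasBoundedSobolevNormsOn {ν : ℝ} (hν : 0 < ν)
    {u : ℝ → EuclideanSpace ℝ (Fin 3) → EuclideanSpace ℝ (Fin 3)}
    {p : ℝ → EuclideanSpace ℝ (Fin 3) → ℝ}
    (hcl : ∀ T : ℝ, 0 < T → IsClassicalNSSolutionOn (Icc 0 T) ν 0 u p)
    (hB : ∀ T : ℝ, 0 < T → HasBoundedSobolevNormsOn (Icc 0 T) u)
    (hE : ∃ C : ℝ≥0∞, C < ⊤ ∧ ∀ t : ℝ, 0 ≤ t → ∫⁻ x, ‖u t x‖ₑ ^ 2 ≤ C) :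
    Tendsto (fun t : ℝ => ∫⁻ x, ‖u t x‖ₑ ^ 2) atTop (𝓝 0) := by
  obtain ⟨C₁, hC₁, hLP⟩ := exists_eLpNorm_two_heatExtension_slice_le
  obtain ⟨A, hAt, hA⟩ := hE
  have hAne : A ≠ ⊤ := hAt.ne
  have hcl1 := hcl 1 one_pos
  have h0I : (0 : ℝ) ∈ Icc (0 : ℝ) 1 := ⟨le_rfl, zero_le_one⟩
  have hu0c : Continuous (u 0) := (hcl1.contDiff_velocity h0I).continuous
  have hu0 : MemLp (u 0) 2 volume := memLp_two_of_lintegral_lt_top hu0c ((hA 0 le_rfl).trans_lt hAt)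
  have hfe : ∀ T : ℝ, ∃ A : ℝ≥0∞, A < ⊤ ∧ ∀ t ∈ Icc 0 T, ∫⁻ x, ‖u t x‖ₑ ^ 2 ≤ A := fun T =>
    ⟨A, hAt, fun t ht => hA t ht.1⟩
  -- reduce to the `L²` norm
  suffices h : Tendsto (fun t : ℝ => eLpNorm (u t) 2 volume) atTop (𝓝 0) by
    have h2 : Tendsto (fun t : ℝ => eLpNorm (u t) 2 volume ^ 2) atTop (𝓝 (0 ^ 2)) :=
      ((ENNReal.continuous_pow 2).tendsto 0).comp h
    rw [zero_pow two_ne_zero] at h2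
    refine h2.congr fun t => ?_
    exact (lintegral_enorm_sq_eq_eLpNorm_sq (u t)).symm
  rw [ENNReal.tendsto_nhds_zero]
  intro ε hε
  by_cases hεtop : ε = ⊤
  · exact Eventually.of_forall fun t => hεtop ▸ le_top
  -- the working accuracy `e = ε / 4`
  set e : ℝ≥0∞ := ε / 4 with he
  have he0 : e ≠ 0 := (ENNReal.div_pos hε.ne' (by norm_num)).ne'
  have hetop : e ≠ ⊤ := ENNReal.div_ne_top hεtop (by norm_num)
  have her : 0 < e.toReal := ENNReal.toReal_pos he0 hetop
  -- (1) the free flow of the datum is eventually `≤ e`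
  obtain ⟨σ₀, hσ₀⟩ := (ENNReal.tendsto_nhds_zero.1 (tendsto_eLpNorm_two_heatExtension_atTop hu0) e
    (pos_iff_ne_zero.2 he0)).exists_forall_of_atTop
  -- (2) the Duhamel tail is eventually `≤ e`
  have htail : Tendsto (fun s : ℝ => A * ENNReal.ofReal (C₁ * ν ^ (-(5 / 4 : ℝ)) * s ^ (-(1 / 4 : ℝ))))
      atTop (𝓝 0) := by
    have h1 : Tendsto (fun s : ℝ => C₁ * ν ^ (-(5 / 4 : ℝ)) * s ^ (-(1 / 4 : ℝ))) atTop (𝓝 0) := by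
      simpa using (tendsto_rpow_neg_atTop (by norm_num : (0 : ℝ) < 1 / 4)).const_mul
        (C₁ * ν ^ (-(5 / 4 : ℝ)))
    have h2 : Tendsto (fun s : ℝ => ENNReal.ofReal (C₁ * ν ^ (-(5 / 4 : ℝ)) * s ^ (-(1 / 4 : ℝ))))
        atTop (𝓝 0) := by simpa using ENNReal.tendsto_ofReal h1
    simpa using ENNReal.Tendsto.const_mul h2 (Or.inr hAne)
  obtain ⟨s₁, hs₁⟩ := (ENNReal.tendsto_nhds_zero.1 htail e (pos_iff_ne_zero.2 he0)).exists_forall_of_atTop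
  -- the smoothing time `s`
  set s : ℝ := max (max (σ₀ / ν) s₁) 0 + 1 with hsdef
  have hs : 0 < s := by
    have : (0 : ℝ) ≤ max (max (σ₀ / ν) s₁) 0 := le_max_right _ _
    linarith
  have hνs : σ₀ ≤ ν * s := by
    have h1 : σ₀ / ν ≤ s :=
      ((le_max_left _ _).trans (le_max_left _ _)).trans (le_add_of_nonneg_right zero_le_one)
    have := mul_le_mul_of_nonneg_left h1 hν.le
    rwa [mul_div_cancel₀ _ hν.ne'] at this
  have hs₁s : s₁ ≤ s :=
    ((le_max_right _ _).trans (le_max_left _ _)).trans (le_add_of_nonneg_right zero_le_one)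
  have hfree : eLpNorm (heatExtension (u 0) (ν * s)) 2 volume ≤ e := hσ₀ _ hνs
  have htail' : A * ENNReal.ofReal (C₁ * ν ^ (-(5 / 4 : ℝ)) * s ^ (-(1 / 4 : ℝ))) ≤ e := hs₁ _ hs₁s
  -- (3) the dissipation threshold `δ` with `√(3 ν s δ) = e`
  set δ : ℝ := e.toReal ^ 2 / (3 * ν * s) with hδdef
  have hδ : 0 < δ := by positivity
  have hsqrt : Real.sqrt (3 * (ν * s) * δ) = e.toReal := by
    rw [hδdef, show 3 * (ν * s) * (e.toReal ^ 2 / (3 * ν * s)) = e.toReal ^ 2 by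
      field_simp]
    exact Real.sqrt_sq her.le
  -- (4) the waiting time
  set T₀ : ℝ := VectorCalculus.kineticEnergy (u 0) / (ν * δ) + 1 with hT₀
  refine eventually_atTop.2 ⟨max T₀ 1, fun t ht => ?_⟩
  have ht1 : 1 ≤ t := (le_max_right _ _).trans ht
  have ht0 : 0 < t := one_pos.trans_le ht1
  have hKE : VectorCalculus.kineticEnergy (u 0) < ν * δ * t := by
    have hνδ : 0 < ν * δ := mul_pos hν hδ
    have h1 : VectorCalculus.kineticEnergy (u 0) / (ν * δ) < t :=
      lt_of_lt_of_le (lt_add_one _) ((le_max_left _ _).trans ht)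
    exact (div_lt_iff₀ hνδ).1 h1 |>.trans_eq (by ring)
  -- the slab `[0, t]`: boundedness from Tao's theory
  have hclt := hcl t ht0
  have hBdd : HasBoundedSobolevNormsOn (Icc 0 t) u := hB t ht0
  obtain ⟨B, hB0, hbd⟩ := exists_forall_norm_le_of_hasBoundedSobolevNormsOn hclt hBdd
  obtain ⟨B', -, hbd'⟩ := exists_forall_norm_fderiv_le_of_hasBoundedSobolevNormsOn
    (fun τ hτ => (hclt.contDiff_velocity hτ).of_le (by norm_cast))
    hBdd
  have hbd1 : ∀ τ ∈ Icc 0 t, ∀ y, ‖u τ y‖ ≤ B + 1 := fun τ hτ y => (hbd τ hτ y).trans (by linarith)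
  -- a good time `τ ∈ (0, t)`
  obtain ⟨τ, hτ, hDτ⟩ := exists_good_time hclt hν ht0 (hfe t) hδ hKE
  have hτI : τ ∈ Icc 0 t := ⟨hτ.1.le, hτ.2.le⟩
  have huτ : MemLp (u τ) 2 volume :=
    memLp_two_of_lintegral_lt_top (hclt.contDiff_velocity hτI).continuous ((hA τ hτ.1.le).trans_lt hAt)
  -- the three bounds at the good time
  have hlow : eLpNorm (heatExtension (u τ) (ν * s)) 2 volume ≤ e + e :=
    (hLP hν ht0 hclt hAne (fun τ' hτ' => hA τ' hτ'.1) (by linarith) hbd1 ⟨hτ.1, hτ.2.le⟩ hs).trans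
      (add_le_add hfree htail')
  have hdefect : eLpNorm (u τ - heatExtension (u τ) (ν * s)) 2 volume ≤ e := by
    have h := eLpNorm_sub_heatExtension_le_of_dissipation
      ((hclt.contDiff_velocity hτI).of_le (by norm_cast))
      (hbd τ hτI) (hbd' τ hτI) huτ hδ.le hDτ
      (mul_pos hν hs)
    rw [hsqrt, ENNReal.ofReal_toReal hetop] at h
    exact h
  have h12 : (1 : ℝ≥0∞) ≤ 2 := by norm_num
  have hm1 : AEStronglyMeasurable (heatExtension (u τ) (ν * s)) volume :=
    (UnboundedOperators.memLp_heatExtension_holds huτ h12 (mul_pos hν hs)).1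
  have hm2 : AEStronglyMeasurable (u τ - heatExtension (u τ) (ν * s)) volume := huτ.1.sub hm1
  have hτbound : eLpNorm (u τ) 2 volume ≤ e + e + e := by
    calc eLpNorm (u τ) 2 volume
        = eLpNorm (heatExtension (u τ) (ν * s) + (u τ - heatExtension (u τ) (ν * s))) 2 volume := by
          rw [add_sub_cancel]
      _ ≤ eLpNorm (heatExtension (u τ) (ν * s)) 2 volume +
            eLpNorm (u τ - heatExtension (u τ) (ν * s)) 2 volume := eLpNorm_add_le hm1 hm2 h12
      _ ≤ e + e + e := add_le_add hlow hdefect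
  -- monotonicity of the `L²` norm from `τ` to `t`
  obtain ⟨hmono, -, -⟩ := energy_facts hclt hν ht0 (hfe t)
  calc eLpNorm (u t) 2 volume ≤ eLpNorm (u τ) 2 volume := hmono hτ.1.le hτ.2.le le_rfl
    _ ≤ e + e + e := hτbound
    _ ≤ e + e + e + e := le_self_add
    _ = ε := by
        rw [he]
        have : ε / 4 + ε / 4 + ε / 4 + ε / 4 = 4 * (ε / 4) := by ring
        rw [this, ENNReal.mul_div_cancel (by norm_num) (by norm_num)]

/-- **`L²` decay of finite-energy classical solutions on `ℝ³` (Masuda 1984, Thm. 4 / Cor. 2 for this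
class; Kato 1984, §4; the question raised in Leray 1934, §34).** Let `ν > 0` and let `(u, p)` be a classical
solution of the unforced Navier–Stokes system on every closed slab `[0, T] × ℝ³`, with a datum of
rapid spatial decay (`HasRapidSpatialDecay (u 0)`, e.g. a Clay datum) and uniformly bounded energy
`∫ |u(t)|² ≤ C < ∞` for `t ≥ 0`. Then `∫ |u(t, x)|² dx → 0` as `t → ∞`.

Proof (all inputs are tree theorems): energy equality (Tao 2013 Lemma 8.1) ⇒ `‖u(t)‖₂` non-increasing
and `ν∫₀^∞‖∇u‖₂² ≤ ½‖u₀‖₂²`, so long slabs contain times `τ` with `‖∇u(τ)‖₂² ≤ δ`; at such a time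
`‖u(τ)‖₂ ≤ ‖e^{νsΔ}u(τ)‖₂ + √(3νsδ)` (Ledoux's defect bound) and
`‖e^{νsΔ}u(τ)‖₂ ≤ ‖e^{νsΔ}u₀‖₂ + C E (νs)^{-1/4}·ν^{-1}` uniformly in `τ` (Oseen representation, heat
low-pass of the Duhamel term through the energy); `‖e^{νsΔ}u₀‖₂ → 0` (`s → ∞`). No rate is asserted
(none holds uniformly on `L²` data). The boundedness of `u` on slabs needed by the Oseen
representation is Tao 2013, Cor. 11.1 (`tao2011_hasBoundedSobolevNormsOn_holds`), which is where the
rapid decay of the datum enters. [cite: Masuda1984, Thm. 4 and Cor. 2 (pp. 628–629)] [cite: Kato1984, §4] [cite: Leray1934, §34] -/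
theorem tendsto_lintegral_enorm_sq_atTop_of_finiteEnergy_classical {ν : ℝ} (hν : 0 < ν)
    {u : ℝ → EuclideanSpace ℝ (Fin 3) → EuclideanSpace ℝ (Fin 3)}
    {p : ℝ → EuclideanSpace ℝ (Fin 3) → ℝ}
    (hcl : ∀ T : ℝ, 0 < T → IsClassicalNSSolutionOn (Icc 0 T) ν 0 u p)
    (hdec : HasRapidSpatialDecay (u 0))
    (hE : ∃ C : ℝ≥0∞, C < ⊤ ∧ ∀ t : ℝ, 0 ≤ t → ∫⁻ x, ‖u t x‖ₑ ^ 2 ≤ C) :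
    Tendsto (fun t : ℝ => ∫⁻ x, ‖u t x‖ₑ ^ 2) atTop (𝓝 0) := by
  obtain ⟨A, hAt, hA⟩ := hE
  refine tendsto_lintegral_enorm_sq_atTop_of_hasBoundedSobolevNormsOn hν hcl (fun T hT => ?_)
    ⟨A, hAt, hA⟩
  exact tao2011_hasBoundedSobolevNormsOn_holds hν hT (hcl T hT)
    ⟨A.toNNReal, fun τ hτ => (hA τ hτ.1).trans (ENNReal.coe_toNNReal hAt.ne).ge⟩ hdec

end EnergyDecay

/-- **Clay-class form (Fefferman (1)–(4), (6)–(7) with `f ≡ 0`).** Let `ν > 0`, let `u₀` have rapidly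
decaying derivatives of all orders, and let `(u, p)` be smooth on `ℝ³ × [0, ∞)`, solve the unforced
Navier–Stokes system with datum `u₀`, and have bounded energy. Then the kinetic energy tends to
zero: `∫ |u(t, x)|² dx → 0` as `t → ∞` — the `L²` decay every global smooth solution of the Clay
problem (A) must exhibit (Masuda 1984; Kato 1984, §4). This is, token for token, the body of the
claim-skeleton Props `Literature.Claims.NS.ArandaIcardo2025.Step_7` and
`Literature.Claims.NS.PaiLimsuwan2026.Step9_Decay`. [cite: Masuda1984, Thm. 4 and Cor. 2 (pp. 628–629)] [cite: Kato1984, §4] -/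
theorem IsNavierStokesSolution.tendsto_lintegral_enorm_sq_atTop {ν : ℝ} (hν : 0 < ν)
    {u₀ : EuclideanSpace ℝ (Fin 3) → EuclideanSpace ℝ (Fin 3)}
    {u : ℝ → EuclideanSpace ℝ (Fin 3) → EuclideanSpace ℝ (Fin 3)}
    {p : ℝ → EuclideanSpace ℝ (Fin 3) → ℝ} (hdec : HasRapidSpatialDecay u₀)
    (hns : IsNavierStokesSolution ν 0 u₀ u p) (hu : IsSmoothOnHalfSpace u)
    (hp : IsSmoothOnHalfSpace p) (hE : HasBoundedEnergy u) :
    Tendsto (fun t : ℝ => ∫⁻ x, ‖u t x‖ₑ ^ 2) atTop (𝓝 0) := by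
  have h0 : u 0 = u₀ := hns.initial
  exact EnergyDecay.tendsto_lintegral_enorm_sq_atTop_of_finiteEnergy_classical hν
    (fun T hT => hns.isClassicalNSSolutionOn_Icc hu hp hT) (h0 ▸ hdec) hE

/-- **Clay-class form, real-valued energy**: under the same hypotheses `∫ |u(t, x)|² dx → 0` as `t → ∞`, with
the Bochner integral (the body of `Literature.Claims.NS.PaiLimsuwan2026.Step9_Decay`, whose `energy` is
real-valued). [cite: Masuda1984, Thm. 4 and Cor. 2 (pp. 628–629)] [cite: Kato1984, §4] -/
theorem IsNavierStokesSolution.tendsto_integral_norm_sq_atTop {ν : ℝ} (hν : 0 < ν)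
    {u₀ : EuclideanSpace ℝ (Fin 3) → EuclideanSpace ℝ (Fin 3)}
    {u : ℝ → EuclideanSpace ℝ (Fin 3) → EuclideanSpace ℝ (Fin 3)}
    {p : ℝ → EuclideanSpace ℝ (Fin 3) → ℝ} (hdec : HasRapidSpatialDecay u₀)
    (hns : IsNavierStokesSolution ν 0 u₀ u p) (hu : IsSmoothOnHalfSpace u)
    (hp : IsSmoothOnHalfSpace p) (hE : HasBoundedEnergy u) :
    Tendsto (fun t : ℝ => ∫ x, ‖u t x‖ ^ 2) atTop (𝓝 0) := by
  have h := hns.tendsto_lintegral_enorm_sq_atTop hν hdec hu hp hE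
  have h' : Tendsto (fun t : ℝ => (∫⁻ x, ‖u t x‖ₑ ^ 2).toReal) atTop (𝓝 (0 : ℝ≥0∞).toReal) :=
    (ENNReal.tendsto_toReal ENNReal.zero_ne_top).comp h
  rw [ENNReal.toReal_zero] at h'
  refine h'.congr' ?_
  filter_upwards [eventually_ge_atTop 0] with t ht
  have hc : Continuous (u t) :=
    ((hns.isClassicalNSSolutionOn_Icc hu hp (show (0 : ℝ) < t + 1 by linarith)).contDiff_velocity
      ⟨ht, by linarith⟩).continuous
  rw [integral_eq_lintegral_of_nonneg_ae (Eventually.of_forall fun x => sq_nonneg _)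
    (hc.norm.pow 2).aestronglyMeasurable]
  congr 1
  refine lintegral_congr fun x => ?_
  rw [← ofReal_norm, ENNReal.ofReal_pow (norm_nonneg _)]

/-- **`H^∞`-datum form**: the same decay for a classical solution on every slab `[0, T] × ℝ³` with bounded
energy whose datum has ALL derivatives in `L²` (no spatial decay rate assumed) — the slab boundedness is the
tree's `IsClassicalNSSolutionOn.hasBoundedSobolevNormsOn_of_sobolevDatum_unforced` (Tao 2013 Cor. 11.1 for
Sobolev data). [cite: Masuda1984, Thm. 4 and Cor. 2 (pp. 628–629)] [cite: Kato1984, §4] -/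
theorem EnergyDecay.tendsto_lintegral_enorm_sq_atTop_of_sobolevDatum {ν : ℝ} (hν : 0 < ν)
    {u : ℝ → EuclideanSpace ℝ (Fin 3) → EuclideanSpace ℝ (Fin 3)}
    {p : ℝ → EuclideanSpace ℝ (Fin 3) → ℝ}
    (hcl : ∀ T : ℝ, 0 < T → IsClassicalNSSolutionOn (Icc 0 T) ν 0 u p)
    (h₀ : ∀ m : ℕ, ∫⁻ x, ‖iteratedFDeriv ℝ m (u 0) x‖ₑ ^ 2 < ⊤)
    (hE : ∃ C : ℝ≥0∞, C < ⊤ ∧ ∀ t : ℝ, 0 ≤ t → ∫⁻ x, ‖u t x‖ₑ ^ 2 ≤ C) :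
    Tendsto (fun t : ℝ => ∫⁻ x, ‖u t x‖ₑ ^ 2) atTop (𝓝 0) := by
  obtain ⟨A, hAt, hA⟩ := hE
  refine EnergyDecay.tendsto_lintegral_enorm_sq_atTop_of_hasBoundedSobolevNormsOn hν hcl
    (fun T hT => ?_) ⟨A, hAt, hA⟩
  exact (hcl T hT).hasBoundedSobolevNormsOn_of_sobolevDatum_unforced hν hT
    ⟨A.toNNReal, fun τ hτ => (hA τ hτ.1).trans (ENNReal.coe_toNNReal hAt.ne).ge⟩ h₀

/-- **Clay-class global dissipation budget**: for `ν > 0` and `(u, p)` smooth on `ℝ³ × [0, ∞)` solving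
the unforced Navier–Stokes system from `u₀` with bounded energy,
`ν ∫₀^∞ ∫ |∇u|²_F ≤ ½ ∫ |u₀|²` (Leray's energy relation on every slab, Tao 2013 Lemma 8.1, summed over
`(0, ∞)`; tree `EnergyDecay.lintegral_Ioi_dissipation_le`). No decay hypothesis on the datum is needed.
[cite: Leray1934, §17 (3.4)] [cite: Tao2011, Lemma 8.1] -/
theorem IsNavierStokesSolution.lintegral_Ioi_dissipation_le {ν : ℝ} (hν : 0 < ν)
    {u₀ : EuclideanSpace ℝ (Fin 3) → EuclideanSpace ℝ (Fin 3)}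
    {u : ℝ → EuclideanSpace ℝ (Fin 3) → EuclideanSpace ℝ (Fin 3)}
    {p : ℝ → EuclideanSpace ℝ (Fin 3) → ℝ}
    (hns : IsNavierStokesSolution ν 0 u₀ u p) (hu : IsSmoothOnHalfSpace u)
    (hp : IsSmoothOnHalfSpace p) (hE : HasBoundedEnergy u) :
    ENNReal.ofReal ν * ∫⁻ τ in Ioi 0, ∫⁻ x, ENNReal.ofReal (frobeniusNormSq (fderiv ℝ (u τ) x)) ≤
      ENNReal.ofReal (VectorCalculus.kineticEnergy u₀) := by
  rw [← hns.initial]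
  exact EnergyDecay.lintegral_Ioi_dissipation_le hν
    (fun T hT => hns.isClassicalNSSolutionOn_Icc hu hp hT) hE

end Literature.Analysis.FluidPDE

end
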